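import Summits.ValiantsHypothesis.ValiantsHypothesis.Statement
import Summits.ValiantsHypothesis.ValiantsHypothesis.Theses.ValuativeGCT
import Summits.ValiantsHypothesis.ValiantsHypothesis.Theorems.ValuativeGCTHeadFlipHolds
import Summits.ValiantsHypothesis.ValiantsHypothesis.Theorems.ValuativeGCTValuativeFlipTailSuffices
import Summits.ValiantsHypothesis.ValiantsHypothesis.Theorems.ValuativeGCTValuativeFlipBorderPaddingMonotone
import Summits.ValiantsHypothesis.ValiantsHypothesis.Theorems.ValuativeGCTValuativeFlipBorderComplexityWindow
import Summits.ValiantsHypothesis.ValiantsHypothesis.Theorems.TailFlip.Negative.TailFlipLoadBearing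
import Summits.ValiantsHypothesis.ValiantsHypothesis.Theorems.TailFlip.Negative.TailFlipKillTransfer

/-! # BC2 cheap probes for the candidate PIECES of the census (Cruxes/TailFlip/STRATEGY-CENSUS.md Part R1, §R1.6)

Each `example` runs the BC2 probe `first | exact? | simpa [C] | (unfold C; simpa) | aesop`, here followed by
`| skip` + `all_goals sorry` so that the file ELABORATES and the number of `sorry` warnings equals the number of FAILED
probes (the raw version without the `sorry` catch, `bc/probes.lean` in the seat folder, is `lean check` rc 1 with
eleven "unsolved goals").  Result (2026-08-17): 11 sorries = all eleven probes P0–P10 FAIL — including P0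
`TailFlip → ValiantsHypothesis`, P5 `DoublingProp → TailFlip`, P7 `HighTail 2 → TailFlip` and P8
`SlopeTwoTail → ValiantsHypothesis`, which are THEOREMS of `StrategistR1Sketch.lean`: the cheap probe is blind
to two-step compositions, so criterion (c) is applied in substance in the census.  Definitions are verbatim
copies of `StrategistR1Sketch.lean` (planner-cstrat-stmt-ValiantsHypothesis-15687-r1-0). -/

set_option linter.dupNamespace false

namespace Summit.ValiantsHypothesis.ValiantsHypothesis.Cruxes.TailFlip.StrategistR1Probes

open Literature.NumberTheory.DiophantineGeometry Literature.Computability.AlgebraicComplexity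
open Summit.ValiantsHypothesis.ValiantsHypothesis.Theses.ValuativeGCT
open Summit.ValiantsHypothesis.ValiantsHypothesis.Theorems.ValuativeFlip
open Summit.ValiantsHypothesis.ValiantsHypothesis.Theorems.TailFlip.Negative

abbrev W (n c : ℕ) : ℕ := 2 ^ ((Nat.log 2 n + c) ^ c)

noncomputable abbrev trunc (m : ℕ) (U : Submodule ℂ (MatIdx m → ℂ)) (r δ : ℕ) (lam : Nat.Partition (m * δ)) :
    Submodule ℂ (MvPolynomial (MatIdx m × MatIdx m) ℂ) :=
  MvPolynomial.homogeneousSubmodule (MatIdx m × MatIdx m) ℂ (m * δ) ⊓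
    ((MvPolynomial.vanishingIdeal ℂ
        {p : MatIdx m × MatIdx m → ℂ | ∀ j : MatIdx m, (fun i => p (j, i)) ∈ U}) ^ (δ * (m - r))).restrictScalars ℂ ⊓
    (⨅ (M : Matrix (MatIdx m) (MatIdx m) ℂ)
      (_ : linSubst (MatIdx m) ℂ M (detFormLex ℂ m) = detFormLex ℂ m),
      LinearMap.ker ((MvPolynomial.aeval (R := ℂ) fun p : MatIdx m × MatIdx m =>
          ∑ l : MatIdx m, M l p.2 • MvPolynomial.X (p.1, l)).toLinearMap -
        LinearMap.id (R := ℂ) (M := MvPolynomial (MatIdx m × MatIdx m) ℂ))) ⊓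
    (⨅ (g : Matrix.GeneralLinearGroup (MatIdx m) ℂ) (_ : IsUpperTriangular g),
      LinearMap.ker ((MvPolynomial.aeval (R := ℂ) fun p : MatIdx m × MatIdx m =>
          ∑ l : MatIdx m, ((g⁻¹ : Matrix.GeneralLinearGroup (MatIdx m) ℂ) :
            Matrix (MatIdx m) (MatIdx m) ℂ) p.1 l • MvPolynomial.X (l, p.2)).toLinearMap -
        weightChar ((Weight.dualOfPartition (m * m) lam).toMatIdx : Weight (MatIdx m)) g •
          LinearMap.id (R := ℂ) (M := MvPolynomial (MatIdx m × MatIdx m) ℂ)))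

noncomputable abbrev perMult (n m δ : ℕ) [NeZero m] (lam : Nat.Partition (m * δ)) : ℕ :=
  orbitMultiplicity ℂ (paddedPerFormLex ℂ n m) m ((Weight.dualOfPartition (m * m) lam).toMatIdx : Weight (MatIdx m))

abbrev Functional : Type := (n m δ : ℕ) → Nat.Partition (m * δ) → ℕ

def PerFloor (F : Functional) : Prop :=
  ∀ a b : ℕ, b < a → ∀ c : ℕ, ∃ n₀ : ℕ, ∀ n ≥ n₀, ∀ (m : ℕ) [NeZero m], a * n < b * m → m ≤ W n c →
    ∃ (δ : ℕ) (lam : Nat.Partition (m * δ)), lam.parts.card ≤ m * m ∧ F n m δ lam ≤ perMult n m δ lam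

def DetCeiling (F : Functional) : Prop :=
  ∀ a b : ℕ, b < a → ∀ c : ℕ, ∃ n₀ : ℕ, ∀ n ≥ n₀, ∀ (m : ℕ) [NeZero m], a * n < b * m → m ≤ W n c →
    ∀ (δ : ℕ) (lam : Nat.Partition (m * δ)), lam.parts.card ≤ m * m →
      ∃ (U : Submodule ℂ (MatIdx m → ℂ)) (r : ℕ),
        (∀ u ∈ U, (Matrix.of fun a b : Fin m => u (toLex (a, b))).rank ≤ r) ∧
          Module.finrank ℂ ↥(trunc m U r δ lam) < F n m δ lam

def DoublingProp : Prop :=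
  ∀ c : ℕ, ∃ n₀ : ℕ, ∀ n ≥ n₀, ∀ (m m' : ℕ) [NeZero m] [NeZero m'],
    n ≤ m → m ≤ m' → m' ≤ 2 * m → m' ≤ W n c → FlipAt n m → FlipAt n m'

def HighTail (k : ℕ) : Prop :=
  ∀ c : ℕ, ∃ n₀ : ℕ, ∀ n ≥ n₀, ∀ (m : ℕ) [NeZero m], n ^ k ≤ m → m ≤ W n c → FlipAt n m

def SlopeTwoTail : Prop :=
  ∀ c : ℕ, ∃ n₀ : ℕ, ∀ n ≥ n₀, ∀ (m : ℕ) [NeZero m], 2 * n < m → m ≤ W n c → FlipAt n m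

/-! ### probes `piece → Statement` and `piece → TailFlip` (and the crux itself → Statement) -/

-- P0: the crux → Statement (the re-audit's claim; two landed steps — does the CHEAP probe see it?)
set_option maxHeartbeats 400000 in
example : TailFlip → _root_.ValiantsHypothesis := by
  first | exact? | simpa [TailFlip] | (unfold TailFlip; simpa) | aesop | skip
  all_goals sorry

-- P1
set_option maxHeartbeats 400000 in
example (F : Functional) : PerFloor F → _root_.ValiantsHypothesis := by
  first | exact? | simpa [PerFloor] | (unfold PerFloor; simpa) | aesop | skip
  all_goals sorry

-- P2
set_option maxHeartbeats 400000 in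
example (F : Functional) : PerFloor F → TailFlip := by
  first | exact? | simpa [PerFloor] | (unfold PerFloor; simpa) | aesop | skip
  all_goals sorry

-- P3
set_option maxHeartbeats 400000 in
example (F : Functional) : DetCeiling F → _root_.ValiantsHypothesis := by
  first | exact? | simpa [DetCeiling] | (unfold DetCeiling; simpa) | aesop | skip
  all_goals sorry

-- P4
set_option maxHeartbeats 400000 in
example (F : Functional) : DetCeiling F → TailFlip := by
  first | exact? | simpa [DetCeiling] | (unfold DetCeiling; simpa) | aesop | skip
  all_goals sorry

-- P5
set_option maxHeartbeats 400000 in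
example : DoublingProp → TailFlip := by
  first | exact? | simpa [DoublingProp] | (unfold DoublingProp; simpa) | aesop | skip
  all_goals sorry

-- P6
set_option maxHeartbeats 400000 in
example : DoublingProp → _root_.ValiantsHypothesis := by
  first | exact? | simpa [DoublingProp] | (unfold DoublingProp; simpa) | aesop | skip
  all_goals sorry

-- P7
set_option maxHeartbeats 400000 in
example : HighTail 2 → TailFlip := by
  first | exact? | simpa [HighTail] | (unfold HighTail; simpa) | aesop | skip
  all_goals sorry

-- P8
set_option maxHeartbeats 400000 in
example : SlopeTwoTail → _root_.ValiantsHypothesis := by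
  first | exact? | simpa [SlopeTwoTail] | (unfold SlopeTwoTail; simpa) | aesop | skip
  all_goals sorry

-- P9 converse direction S → piece (recorded per BC2): S → PerFloor F
set_option maxHeartbeats 400000 in
example (F : Functional) : _root_.ValiantsHypothesis → PerFloor F := by
  first | exact? | simpa [PerFloor] | (unfold PerFloor; simpa) | aesop | skip
  all_goals sorry

-- P10: S → DetCeiling F
set_option maxHeartbeats 400000 in
example (F : Functional) : _root_.ValiantsHypothesis → DetCeiling F := by
  first | exact? | simpa [DetCeiling] | (unfold DetCeiling; simpa) | aesop | skip
  all_goals sorry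

end Summit.ValiantsHypothesis.ValiantsHypothesis.Cruxes.TailFlip.StrategistR1Probes
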